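import Literature.NumberTheory.LFunctions.SchoenfeldZeroSums
import Summits.RiemannHypothesis.RiemannHypothesis.Theorems.Splittings.EarlyAppointmentsXiZetaDictionary
import Summits.RiemannHypothesis.RiemannHypothesis.Theorems.HandoffXiZeroCount

/-!
# ⟨24730⟩ ρ2 — HEIGHT SUMS over the zeros of `Ξ` = Schoenfeld's `zerosBetween` sums; ABEL SUMMATION against `N(t)`

C4 «kernel desk» rh-idea-6 g30, director (CA403)(iii).  SUPPORT module (fully proved, no `sorry`; imports: Literature
`SchoenfeldZeroSums` + tree `Splittings.EarlyAppointmentsXiZetaDictionary` only) for crux r3 `Remainder0Xi` (stmt-RiemannHypothesis-24730),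
line `rho2_v3`, stub `stub_farAbel`, LEAF 2 (`AbelMainLeaf`) of `…Theorems/EarlyAppointmentsRemainder0XiFarAbelSkeleton`.
This is the indexing bridge the hands named as the blocker of the Abel step ("connects two different indexing
schemes"): the route's sums run over zeros `ρ` of `Ξ` (`Ξ(z) = ξ(1/2 + iz)`) weighted by the ANALYTIC ORDER of `Ξ`
and evaluated at the HEIGHT `Re ρ`, while the tree's Abel-summation lemma
`Literature…SchoenfeldBound.sum_zerosBetween_eq` [RosserSchoenfeld1975, Lemma 7] and the counting function
`zetaZeroCount = N` run over zeros `ρ' = 1/2 + iρ` of `ζ` weighted by `riemannZetaZeroOrder` at the height `Im ρ'`.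

* `finsum_heights_eq_sum_zerosBetween` — for `0 ≤ a ≤ b` and any `g : ℝ → ℝ`:
  `∑ᶠ ρ ∈ {Ξ ρ = 0, a < Re ρ ≤ b}, ord_Ξ(ρ) · g (Re ρ) = ∑ ρ' ∈ zerosBetween a b, m_ζ(ρ') · g (Im ρ')`
  (bijection `z ↦ 1/2 + iz` as in the dictionary's `xiDictHalfOpen_holds`, multiplicities by its `xiOrd_eq_zetaOrder`).
* ★ `finsum_heights_abel` — the same sum `= (N b − N a) · g b − ∫_a^b (N t − N a) · g′ t` for `g ∈ C¹[a, b]`.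
* `finsum_farBox_split` / `finsum_closedHeightBox_split` — the route's FAR BOX
  `{Ξ ρ = 0, 0 < Re ρ ≤ T, h ≤ |Re ρ − x|}` (…FarAbelSkeleton `farBoxAt x T` with `h = boxHalfWidth`) is
  `(0, x − h] ∪ (x + h, T] ∪ {height = x + h}` as finsums, so `farHeightSum x T` = two Abel-summable height sums
  + a boundary term (zero unless a zero sits at height exactly `x + h`).
Nothing here bears on the truth of RH; RH is not proved; 24730 OPEN.
-/

noncomputable section

set_option linter.dupNamespace false

open Literature.NumberTheory.LFunctions

namespace Summit.RiemannHypothesis.RiemannHypothesis.Theorems.EarlyAppointmentsRemainder0Xi.HeightSumAbel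

open Complex Set MeasureTheory
open Literature.NumberTheory.LFunctions.SchoenfeldBound (zerosBetween mem_zerosBetween sum_zerosBetween_eq)
open Summit.RiemannHypothesis.RiemannHypothesis.Theorems.Splittings.EarlyAppointmentsXiZetaDictionary
  (xiOrd xiOrd_eq_zetaOrder xiZerosHalfOpen_finite)

/-- The zeros of `Ξ` with heights in `(a, b]`. -/
def heightBox (a b : ℝ) : Set ℂ := {ρ : ℂ | riemannXiUpper ρ = 0 ∧ a < ρ.re ∧ ρ.re ≤ b}

/-- The height box `(a, b]` is finite. -/
theorem heightBox_finite (a b : ℝ) : (heightBox a b).Finite := xiZerosHalfOpen_finite a b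

/-- A zero `ρ` of `Ξ` gives the zero `1/2 + iρ` of `ζ` in the open critical strip. -/
theorem zeta_zero_of_xi_zero {ρ : ℂ} (hρ : riemannXiUpper ρ = 0) :
    riemannZeta (1 / 2 + I * ρ) = 0 ∧ 0 < (1 / 2 + I * ρ).re ∧ (1 / 2 + I * ρ).re < 1 :=
  (riemannXi_eq_zero_iff_holds (1 / 2 + I * ρ)).1 hρ

/-- Use existing `im_half_add_I_mul` (avoids dedup.landed). -/
private abbrev im_half_add_I_mul := Summit.RiemannHypothesis.RiemannHypothesis.Theorems.CountThin.im_half_add_I_mul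

/-- The analytic order of `Ξ` at a zero `ρ`, read in `ℝ`, is the multiplicity of `ζ` at `1/2 + iρ`. -/
theorem ord_eq_zetaOrder {ρ : ℂ} (hρ : riemannXiUpper ρ = 0) :
    ((analyticOrderAt riemannXiUpper ρ).toNat : ℝ) = (riemannZetaZeroOrder (1 / 2 + I * ρ) : ℝ) := by
  obtain ⟨-, h0, h1⟩ := zeta_zero_of_xi_zero hρ
  exact xiOrd_eq_zetaOrder h0 h1

/-- **Reindexing**: a height sum over the zeros of `Ξ` in `(a, b]` (weights = analytic orders) is Schoenfeld's
`zerosBetween a b` sum (weights = `riemannZetaZeroOrder`). -/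
theorem finsum_heights_eq_sum_zerosBetween {a b : ℝ} (ha : 0 ≤ a) (g : ℝ → ℝ) :
    ∑ᶠ ρ ∈ heightBox a b, ((analyticOrderAt riemannXiUpper ρ).toNat : ℝ) * g ρ.re =
      ∑ ρ' ∈ zerosBetween a b, (riemannZetaZeroOrder ρ' : ℝ) * g ρ'.im := by
  classical
  rw [finsum_mem_eq_finite_toFinset_sum _ (heightBox_finite a b)]
  refine Finset.sum_nbij' (fun z ↦ 1 / 2 + I * z) (fun ρ' ↦ -I * (ρ' - 1 / 2)) ?_ ?_ ?_ ?_ ?_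
  · intro z hz
    obtain ⟨hz0, h1, h2⟩ := (Set.Finite.mem_toFinset _).mp hz
    obtain ⟨hζ, hre0, hre1⟩ := zeta_zero_of_xi_zero hz0
    refine (mem_zerosBetween ha).2 ⟨hζ, hre0.le, hre1.le, ?_, ?_⟩
    · rw [im_half_add_I_mul]; exact h1
    · rw [im_half_add_I_mul]; exact h2
  · intro ρ' hρ'
    obtain ⟨hζ, -, -, him1, him2⟩ := (mem_zerosBetween ha).1 hρ'
    have him0 : 0 < ρ'.im := ha.trans_lt him1
    obtain ⟨h0, h1⟩ := re_mem_Ioo_of_riemannZeta_eq_zero_of_im_ne_zero hζ him0.ne'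
    refine (Set.Finite.mem_toFinset _).mpr ⟨?_, ?_, ?_⟩
    · have hρ'' : (1 / 2 : ℂ) + I * (-I * (ρ' - 1 / 2)) = ρ' := by
        linear_combination (-(ρ' - 1 / 2)) * Complex.I_mul_I
      rw [riemannXiUpper, hρ'']
      exact (riemannXi_eq_zero_iff_holds ρ').mpr ⟨hζ, h0, h1⟩
    · simpa using him1
    · simpa using him2
  · intro z _
    linear_combination -z * Complex.I_mul_I
  · intro ρ' _
    linear_combination (-(ρ' - 1 / 2)) * Complex.I_mul_I
  · intro z hz
    obtain ⟨hz0, -, -⟩ := (Set.Finite.mem_toFinset _).mp hz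
    rw [ord_eq_zetaOrder hz0, im_half_add_I_mul]

/-- ★ **Abel summation of a height sum against `N(t)`** [RosserSchoenfeld1975, Lemma 7, through the reindexing]:
for `0 ≤ a ≤ b` and `g ∈ C¹[a, b]`,
`∑ᶠ_{Ξ ρ = 0, a < Re ρ ≤ b} ord_Ξ(ρ) g(Re ρ) = (N(b) − N(a)) g(b) − ∫_a^b (N(t) − N(a)) g′(t) dt`. -/
theorem finsum_heights_abel {a b : ℝ} (ha : 0 ≤ a) (hab : a ≤ b) {g g' : ℝ → ℝ}
    (hg : ∀ t ∈ Icc a b, HasDerivAt g (g' t) t) (hg' : ContinuousOn g' (Icc a b)) :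
    ∑ᶠ ρ ∈ heightBox a b, ((analyticOrderAt riemannXiUpper ρ).toNat : ℝ) * g ρ.re =
      ((zetaZeroCount b : ℝ) - zetaZeroCount a) * g b -
        ∫ t in a..b, ((zetaZeroCount t : ℝ) - zetaZeroCount a) * g' t := by
  rw [finsum_heights_eq_sum_zerosBetween ha g]
  exact sum_zerosBetween_eq ha hab hg hg'

/-! ## The far box of the route, split at the window: `(0, x − h] ∪ [x + h, T]` -/

open Summit.RiemannHypothesis.RiemannHypothesis.Theorems.Splittings.EarlyAppointmentsXiZetaDictionary
  (xiZerosWindowFinite_holds)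

/-- The zeros of `Ξ` with heights in the CLOSED interval `[a, b]`. -/
def closedHeightBox (a b : ℝ) : Set ℂ := {ρ : ℂ | riemannXiUpper ρ = 0 ∧ a ≤ ρ.re ∧ ρ.re ≤ b}

/-- The closed height box `[a, b]` is finite. -/
theorem closedHeightBox_finite (a b : ℝ) : (closedHeightBox a b).Finite := xiZerosWindowFinite_holds a b

/-- The route's far box at `x` (half-width `h`, truncated at `T`) is `(0, x − h] ∪ [x + h, T]` in heights. -/
theorem farBox_eq_union {x h T : ℝ} (hh : 0 < h) (hx : 0 ≤ x - h) (hT : x + h ≤ T) :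
    {ρ : ℂ | riemannXiUpper ρ = 0 ∧ 0 < ρ.re ∧ ρ.re ≤ T ∧ h ≤ |ρ.re - x|} =
      heightBox 0 (x - h) ∪ closedHeightBox (x + h) T := by
  ext ρ
  simp only [heightBox, closedHeightBox, Set.mem_setOf_eq, Set.mem_union]
  constructor
  · rintro ⟨h0, h1, h2, h3⟩
    rcases le_abs'.1 h3 with h4 | h4
    · exact Or.inl ⟨h0, h1, by linarith⟩
    · exact Or.inr ⟨h0, by linarith, h2⟩
  · rintro (⟨h0, h1, h2⟩ | ⟨h0, h1, h2⟩)
    · exact ⟨h0, h1, by linarith, le_abs'.2 (Or.inl (by linarith))⟩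
    · exact ⟨h0, by linarith, h2, le_abs'.2 (Or.inr (by linarith))⟩

/-- The low and high height boxes are disjoint. -/
theorem disjoint_low_high {x h T : ℝ} (hh : 0 < h) :
    Disjoint (heightBox 0 (x - h)) (closedHeightBox (x + h) T) := by
  refine Set.disjoint_left.2 fun ρ ⟨_, _, h2⟩ ⟨_, h3, _⟩ ↦ ?_
  linarith

/-- **Far-box split**: the far height sum is the low sum over `(0, x − h]` plus the high sum over `[x + h, T]`. -/
theorem finsum_farBox_split {x h T : ℝ} (hh : 0 < h) (hx : 0 ≤ x - h) (hT : x + h ≤ T) (F : ℂ → ℝ) :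
    ∑ᶠ ρ ∈ {ρ : ℂ | riemannXiUpper ρ = 0 ∧ 0 < ρ.re ∧ ρ.re ≤ T ∧ h ≤ |ρ.re - x|}, F ρ =
      (∑ᶠ ρ ∈ heightBox 0 (x - h), F ρ) + ∑ᶠ ρ ∈ closedHeightBox (x + h) T, F ρ := by
  rw [farBox_eq_union hh hx hT,
    finsum_mem_union (disjoint_low_high (T := T) hh) (heightBox_finite 0 (x - h)) (closedHeightBox_finite _ _)]

/-- The closed window `[a, b]` is the half-open window `(a, b]` plus the boundary height `a`. -/
theorem closedHeightBox_eq_union {a b : ℝ} (hab : a ≤ b) :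
    closedHeightBox a b = heightBox a b ∪ closedHeightBox a a := by
  ext ρ
  simp only [heightBox, closedHeightBox, Set.mem_setOf_eq, Set.mem_union]
  constructor
  · rintro ⟨h0, h1, h2⟩
    rcases h1.lt_or_eq with h3 | h3
    · exact Or.inl ⟨h0, h3, h2⟩
    · exact Or.inr ⟨h0, h3.le, h3.ge⟩
  · rintro (⟨h0, h1, h2⟩ | ⟨h0, h1, h2⟩)
    · exact ⟨h0, h1.le, h2⟩
    · exact ⟨h0, h1, h2.trans hab⟩

/-- **Boundary split**: the high sum over `[a, b]` is the half-open sum over `(a, b]` (the one Abel summation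
handles, `finsum_heights_abel`) plus the boundary term (the zeros at height exactly `a`, if any). -/
theorem finsum_closedHeightBox_split {a b : ℝ} (hab : a ≤ b) (F : ℂ → ℝ) :
    ∑ᶠ ρ ∈ closedHeightBox a b, F ρ = (∑ᶠ ρ ∈ heightBox a b, F ρ) + ∑ᶠ ρ ∈ closedHeightBox a a, F ρ := by
  rw [closedHeightBox_eq_union hab,
    finsum_mem_union ?_ (heightBox_finite a b) (closedHeightBox_finite a a)]
  exact Set.disjoint_left.2 fun ρ ⟨_, h1, _⟩ ⟨_, _, h3⟩ ↦ by linarith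

/-- The boundary term is a sum of nonnegative multiples: with a nonnegative weight-kernel it is bounded by
`(N(a) − N(a − δ))`-type counts; here only its SHAPE is recorded: it vanishes when no zero has height exactly `a`. -/
theorem finsum_boundary_eq_zero {a : ℝ} (F : ℂ → ℝ) (h : ∀ ρ : ℂ, riemannXiUpper ρ = 0 → ρ.re ≠ a) :
    ∑ᶠ ρ ∈ closedHeightBox a a, F ρ = 0 := by
  have he : closedHeightBox a a = ∅ :=
    Set.eq_empty_iff_forall_notMem.2 fun ρ ⟨h0, h1, h2⟩ ↦ h ρ h0 (le_antisymm h2 h1)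
  rw [he, finsum_mem_empty]

end Summit.RiemannHypothesis.RiemannHypothesis.Theorems.EarlyAppointmentsRemainder0Xi.HeightSumAbel

end
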